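import Summits.QuantumFields.YangMills.Theorems.ColdStartUniversalityShenZhuZhuRiemannDistComparisonSU2
import Mathlib.Geometry.Euclidean.Angle.Unoriented.TriangleInequality
import Mathlib.Analysis.InnerProductSpace.PiL2
import HarnessLib

/-!
# Shen–Zhu–Zhu's Riemannian distance on `SU(2)` and its product version `ρ_L` satisfy the TRIANGLE INEQUALITY:
# `ρ(g,k) ≤ ρ(g,h) + ρ(h,k)` (spherical triangle inequality on `S³`) and `ρ_L(U,U'') ≤ ρ_L(U,U') + ρ_L(U',U'')`

Seat `ym-line-csu-p1` (g41), route `ColdStartUniversality` of `Summits/QuantumFields/YangMills`, helper file G45 (`--supports stmt-QuantumFields-24809`).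
With G40/G41 (`ρ(g,h) = √2·arccos(Re tr(h gᴴ)/2)`, symmetry, `ρ = 0 ↔ g = h`) this makes `ρ` a genuine METRIC on `SU(2)` and
`ρ_L = √(torusRiemannDistSq)` a genuine metric on `SU(2)^E` — so the Lipschitz seminorm contracted in G44 (`wilson_riemannLipschitz_contraction_uniform`)
is a Lipschitz seminorm for an honest distance.  The Literature's `LatticeRep.riemannDist` is an infimum over ONE-STEP logarithms, for which the
triangle inequality is not formal (`e^X e^Y ≠ e^(X+Y)`); on `SU(2)` it follows from the identification with the angle metric of the round sphere
`S³ ⊂ ℝ⁸ ≅ M₂(ℂ)` (real and imaginary parts of the entries, Hilbert–Schmidt inner product) and Mathlib's triangle inequality for angles between vectors.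

* `realVec_two` plumbing: `⟪vec g, vec h⟫ = Re tr(g hᴴ)`, `‖vec g‖ = √2` on `SU(2)`;
* ★ `riemannDist_two_eq_sqrt_two_mul_angle` — `ρ(g,h) = √2 · ∠(vec g, vec h)`;
* ★★★ `riemannDist_two_triangle` — `ρ(g,k) ≤ ρ(g,h) + ρ(h,k)`;
* ★★ `sqrt_torusRiemannDistSq_two_triangle` — `ρ_L(U,U'') ≤ ρ_L(U,U') + ρ_L(U',U'')` on every torus (Minkowski in `ℓ²(E)`);
  `sqrt_torusRiemannDistSq_two_comm`, `sqrt_torusRiemannDistSq_two_eq_zero_iff`.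

THEOREMS ONLY, no definition, no sorry (no `MetricSpace` instance is registered — Theorems files declare no instances).  HONEST FRAMING: metric
geometry of `SU(2)^E`; nothing about the route's scaling; `UniformColdStartMixing` (24809, ASIDE) not restated; no crux, rung or summit statement is
proved; the Yang–Mills mass gap is NOT proved.

References: S. Gallot, D. Hulin, J. Lafontaine, *Riemannian Geometry* (2004), 2.91 (the Riemannian distance is a distance) [GallotHulinLafontaine2004];
H. Shen, R. Zhu, X. Zhu, CMP 400 (2023) 805–851, §4.1 [ShenZhuZhu2022].
-/

set_option autoImplicit false

noncomputable section

namespace Summit.QuantumFields.YangMills.Theorems.ColdStartUniversality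

open Matrix Complex Finset InnerProductGeometry
open scoped ComplexConjugate BigOperators Real RealInnerProductSpace
open Literature.MathematicalPhysics.QuantumFieldTheory
open Literature.MathematicalPhysics.QuantumLattice (fundamentalRep fundamentalLatticeRep fundamentalRep_apply fundamentalLatticeRep_N)

/-! ## §1. `M₂(ℂ)` as the real inner product space `ℝ⁸` -/

/-- The Hilbert–Schmidt pairing of two matrices is the Euclidean inner product of their real coordinate vectors (real and imaginary parts of the
entries). [folklore] -/
theorem inner_toLp_reIm_eq_hsForm (X Y : Matrix (Fin 2) (Fin 2) ℂ) :
    ⟪(WithLp.toLp 2 (fun q : Fin 2 × Fin 2 × Bool => if q.2.2 then (X q.1 q.2.1).im else (X q.1 q.2.1).re) : EuclideanSpace ℝ (Fin 2 × Fin 2 × Bool)),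
      (WithLp.toLp 2 (fun q : Fin 2 × Fin 2 × Bool => if q.2.2 then (Y q.1 q.2.1).im else (Y q.1 q.2.1).re) : EuclideanSpace ℝ (Fin 2 × Fin 2 × Bool))⟫ =
      hsForm 2 X Y := by
  rw [EuclideanSpace.inner_toLp_toLp, dotProduct, hsForm_eq_sum_entries]
  simp only [star_trivial]
  rw [Fintype.sum_prod_type]
  refine Finset.sum_congr rfl fun i _ => ?_
  rw [Fintype.sum_prod_type]
  refine Finset.sum_congr rfl fun j _ => ?_
  rw [Fintype.sum_bool]
  simp only [if_true, Bool.false_eq_true, if_false, Complex.mul_re, Complex.conj_re, Complex.conj_im]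
  ring

/-- The coordinate vector of `g ∈ SU(2)` has Euclidean norm `√2` (`‖g‖_F² = Re tr(g gᴴ) = 2`). [folklore] -/
theorem norm_toLp_reIm_two (g : Matrix.specialUnitaryGroup (Fin 2) ℂ) :
    ‖(WithLp.toLp 2 (fun q : Fin 2 × Fin 2 × Bool => if q.2.2 then ((g : Matrix (Fin 2) (Fin 2) ℂ) q.1 q.2.1).im else ((g : Matrix (Fin 2) (Fin 2) ℂ) q.1 q.2.1).re) :
      EuclideanSpace ℝ (Fin 2 × Fin 2 × Bool))‖ = Real.sqrt 2 := by
  have h := inner_toLp_reIm_eq_hsForm (g : Matrix (Fin 2) (Fin 2) ℂ) (g : Matrix (Fin 2) (Fin 2) ℂ)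
  have h2 : hsForm 2 (g : Matrix (Fin 2) (Fin 2) ℂ) (g : Matrix (Fin 2) (Fin 2) ℂ) = 2 := hsForm_self_fundamentalRep g
  rw [real_inner_self_eq_norm_sq, h2] at h
  rw [← Real.sqrt_sq (norm_nonneg _), h]

/-! ## §2. `ρ = √2 · angle`, and the triangle inequality on `SU(2)` -/

/-- ★ **`ρ(g,h) = √2 · ∠(vec g, vec h)`**: Shen–Zhu–Zhu's Riemannian distance on `SU(2)` is `√2` times the angle between the unit quaternions
`g/√2`, `h/√2` in `ℝ⁸ ≅ M₂(ℂ)`. [cite: GallotHulinLafontaine2004, 2.90] -/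
theorem riemannDist_two_eq_sqrt_two_mul_angle (g h : Matrix.specialUnitaryGroup (Fin 2) ℂ) :
    (fundamentalLatticeRep 2).riemannDist g h = Real.sqrt 2 *
      angle (WithLp.toLp 2 (fun q : Fin 2 × Fin 2 × Bool => if q.2.2 then ((g : Matrix (Fin 2) (Fin 2) ℂ) q.1 q.2.1).im else ((g : Matrix (Fin 2) (Fin 2) ℂ) q.1 q.2.1).re) :
          EuclideanSpace ℝ (Fin 2 × Fin 2 × Bool))
        (WithLp.toLp 2 (fun q : Fin 2 × Fin 2 × Bool => if q.2.2 then ((h : Matrix (Fin 2) (Fin 2) ℂ) q.1 q.2.1).im else ((h : Matrix (Fin 2) (Fin 2) ℂ) q.1 q.2.1).re) :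
          EuclideanSpace ℝ (Fin 2 × Fin 2 × Bool)) := by
  rw [riemannDist_two_eq, angle, inner_toLp_reIm_eq_hsForm, norm_toLp_reIm_two, norm_toLp_reIm_two, Real.mul_self_sqrt (by norm_num : (0:ℝ) ≤ 2),
    hsForm_comm, hsForm_apply, Matrix.star_eq_conjTranspose]

/-- ★★★ **Triangle inequality for Shen–Zhu–Zhu's Riemannian distance on `SU(2)`**: `ρ(g,k) ≤ ρ(g,h) + ρ(h,k)` (spherical triangle inequality).
[cite: GallotHulinLafontaine2004, 2.91] -/
theorem riemannDist_two_triangle (g h k : Matrix.specialUnitaryGroup (Fin 2) ℂ) :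
    (fundamentalLatticeRep 2).riemannDist g k ≤ (fundamentalLatticeRep 2).riemannDist g h + (fundamentalLatticeRep 2).riemannDist h k := by
  rw [riemannDist_two_eq_sqrt_two_mul_angle, riemannDist_two_eq_sqrt_two_mul_angle, riemannDist_two_eq_sqrt_two_mul_angle, ← mul_add]
  exact mul_le_mul_of_nonneg_left (angle_le_angle_add_angle _ _ _) (Real.sqrt_nonneg 2)

/-! ## §3. The product distance `ρ_L = √(Σ_e ρ(U_e,U'_e)²)` on `SU(2)^E` -/

/-- ★★ **Triangle inequality for `ρ_L`** on every torus `(ℤ/L)^d`, `SU(2)` links: `ρ_L(U,U'') ≤ ρ_L(U,U') + ρ_L(U',U'')` (the link-wise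
triangle inequality and Minkowski's inequality in `ℓ²(E)`). [cite: ShenZhuZhu2022, §4.1] -/
theorem sqrt_torusRiemannDistSq_two_triangle {d L : ℕ} [NeZero L] (U U' U'' : GaugeConfig d L (Matrix.specialUnitaryGroup (Fin 2) ℂ)) :
    Real.sqrt (torusRiemannDistSq (fundamentalLatticeRep 2) U U'') ≤
      Real.sqrt (torusRiemannDistSq (fundamentalLatticeRep 2) U U') + Real.sqrt (torusRiemannDistSq (fundamentalLatticeRep 2) U' U'') := by
  classical
  -- the three vectors of link distances in `ℓ²(E)`
  set x : EuclideanSpace ℝ (Edge d L) := WithLp.toLp 2 (fun e => (fundamentalLatticeRep 2).riemannDist (U e) (U' e)) with hx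
  set y : EuclideanSpace ℝ (Edge d L) := WithLp.toLp 2 (fun e => (fundamentalLatticeRep 2).riemannDist (U' e) (U'' e)) with hy
  have hnx : ‖x‖ = Real.sqrt (torusRiemannDistSq (fundamentalLatticeRep 2) U U') := by
    rw [EuclideanSpace.norm_eq]; unfold torusRiemannDistSq
    congr 1; refine Finset.sum_congr rfl fun e _ => ?_
    rw [hx, PiLp.toLp_apply, Real.norm_eq_abs, sq_abs]
  have hny : ‖y‖ = Real.sqrt (torusRiemannDistSq (fundamentalLatticeRep 2) U' U'') := by
    rw [EuclideanSpace.norm_eq]; unfold torusRiemannDistSq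
    congr 1; refine Finset.sum_congr rfl fun e _ => ?_
    rw [hy, PiLp.toLp_apply, Real.norm_eq_abs, sq_abs]
  have hnxy : Real.sqrt (torusRiemannDistSq (fundamentalLatticeRep 2) U U'') ≤ ‖x + y‖ := by
    rw [EuclideanSpace.norm_eq]; unfold torusRiemannDistSq
    refine Real.sqrt_le_sqrt (Finset.sum_le_sum fun e _ => ?_)
    rw [Real.norm_eq_abs, sq_abs]
    have h0 := (fundamentalLatticeRep 2).riemannDist_nonneg (U e) (U'' e)
    have htri := riemannDist_two_triangle (U e) (U' e) (U'' e)
    have hsum : (x + y) e = (fundamentalLatticeRep 2).riemannDist (U e) (U' e) + (fundamentalLatticeRep 2).riemannDist (U' e) (U'' e) := by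
      rw [hx, hy]; rfl
    rw [hsum]
    exact pow_le_pow_left₀ h0 htri 2
  calc Real.sqrt (torusRiemannDistSq (fundamentalLatticeRep 2) U U'') ≤ ‖x + y‖ := hnxy
    _ ≤ ‖x‖ + ‖y‖ := norm_add_le x y
    _ = _ := by rw [hnx, hny]

/-- `ρ_L` is symmetric. [cite: ShenZhuZhu2022, §4.1] -/
theorem torusRiemannDistSq_two_comm {d L : ℕ} [NeZero L] (U U' : GaugeConfig d L (Matrix.specialUnitaryGroup (Fin 2) ℂ)) :
    torusRiemannDistSq (fundamentalLatticeRep 2) U U' = torusRiemannDistSq (fundamentalLatticeRep 2) U' U := by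
  unfold torusRiemannDistSq
  exact Finset.sum_congr rfl fun e _ => by rw [riemannDist_two_comm]

/-- `ρ_L(U,U') = 0 ↔ U = U'`: `ρ_L` is a genuine metric on `SU(2)^E`. [cite: ShenZhuZhu2022, §4.1] -/
theorem torusRiemannDistSq_two_eq_zero_iff {d L : ℕ} [NeZero L] (U U' : GaugeConfig d L (Matrix.specialUnitaryGroup (Fin 2) ℂ)) :
    torusRiemannDistSq (fundamentalLatticeRep 2) U U' = 0 ↔ U = U' := by
  unfold torusRiemannDistSq
  rw [Finset.sum_eq_zero_iff_of_nonneg (fun e _ => sq_nonneg _)]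
  constructor
  · intro h; funext e
    have he := h e (Finset.mem_univ e)
    rw [sq_eq_zero_iff, riemannDist_two_eq_zero_iff] at he
    exact he
  · intro h e _
    rw [h, (fundamentalLatticeRep 2).riemannDist_self, sq, mul_zero]

end Summit.QuantumFields.YangMills.Theorems.ColdStartUniversality

end
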